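import Summits.BirchSwinnertonDyer.BirchSwinnertonDyer.Theorems.SylvesterTwoHeegnerIndexCMFlipLevelPair
import Summits.BirchSwinnertonDyer.BirchSwinnertonDyer.Theorems.SylvesterTwoHeegnerIndexCMFlipBlockOne
import Summits.BirchSwinnertonDyer.BirchSwinnertonDyer.Theorems.SylvesterTwoHeegnerIndexCMFlipPairLift
import Literature.NumberTheory.EllipticCurves.HuShuYin2019.SylvesterPairGoodPlaces
import Summits.BirchSwinnertonDyer.BirchSwinnertonDyer.Theorems.SylvesterTwoHeegnerIndexCMHalfPairPackage
import HarnessLib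

/-!
# (S8) of leaf (L1) at `p ≡ 7 (mod 9)`, crux `UpperOffV0HSYPlus` (stmt-BirchSwinnertonDyer-19804): HALF BLOCK 2 — the FLIP
# at the pair level `9pℓℓ′` for the HALVED classes, «`c′_B(ℓℓ′)` Selmer at `λ ∋ ℓ` ↔ `c′_A(ℓ′) ∈ T_A(λ)`»

Skeleton VARIANT M 406ca288e244d392, stub `stub_layerL1Seven`; planner D507 (4), D510.  Twin of g24's #H-c2
`block2_of_level` for the HALF index set `(𝒢₀⧸H) × H′`: #H-c2's binders with the generic representatives `t, ht`
replaced by the bottom product representatives (#H-a), `∛3, ∛p`, `H`, the involution datum (`s`, `s² = 1`, a half `H′`)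
and THE TOWER FIXING AT `n = ℓℓ′` (`φ ∈ Aut_K K[9pℓℓ′]` restricting to `s`, `φ · y_{ℓℓ′} = y_{ℓℓ′}`; memo two §67.2 (W2-b),
DISPLAYED, not proved); the level-`ℓ′` inputs `hA₁′, hQN′, hP₁′` are those of the HALF class `c′_A(ℓ′)` (#S4/#S6).
Proof = #H-c2's except: the pair-level invariance comes from #S7 `half_chiComponentB_pair_mem_invPoints`, and the
invariance of the `ℓ′`-class read at the pair level is TRANSPORTED from `hP₁′` along `E₉(K̄)^{N′} ⊆ E₉(K̄)^N`; #F2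
`flip_levelPair` (index-generic) is called as is.  Theorems only; no `def`/`sorry`/new `Prop`; scoped
`maxHeartbeats 1600000`; free level `m = 9p(ℓℓ′)`.  HONEST LABEL: conditional on the DISPLAYED TOWER FIXING binders
(cell lemma W2-b, unrefereed) + (ES2) by name; nothing asserted on 19804; no stub closed; X12.CMAtTwo NOT proved; BSD
is not proved by any of this.  `--supports stmt-BirchSwinnertonDyer-19804 --as helper`.
-/

set_option linter.dupNamespace false
set_option autoImplicit false

noncomputable section

open scoped Classical Pointwise

namespace Summit.BirchSwinnertonDyer.BirchSwinnertonDyer.Theorems.SylvesterTwoCMHalf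

open WeierstrassCurve Field NumberField IsDedekindDomain Finset
open Literature.NumberTheory.EllipticCurves Literature.NumberTheory.GaloisRepresentations
  Literature.NumberTheory.EllipticCurves.ModularForms
  Literature.NumberTheory.EllipticCurves.HuShuYin2019
  Literature.NumberTheory.EllipticCurves.KolyvaginCocycle
  Literature.NumberTheory.EllipticCurves.RingClassField
  Literature.NumberTheory.QuadraticFields Literature.NumberTheory.QuadraticFields.RingClass
  Literature.NumberTheory.QuadraticFields.Quadratic
  Summit.BirchSwinnertonDyer.BirchSwinnertonDyer.Theorems.SylvesterTwoCMData
  Summit.BirchSwinnertonDyer.Rank1Residual.X11b Summit.BirchSwinnertonDyer.Rank1Residual.X11b.RingClassTower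

open Summit.BirchSwinnertonDyer.BirchSwinnertonDyer.Theorems.SylvesterTwoCMFlip

variable {K : Type} [Field K] [NumberField K]

set_option maxHeartbeats 1600000 in
/-- **HALF BLOCK 2 OF (L1) AT A PAIR OF KOLYVAGIN PRIMES** (`p ≡ 7 (mod 9)` architecture): for the HALF class terms at
the level `m = 9pℓℓ′` built from the tower-fixed CM point, `c′_B(ℓℓ′)` is Selmer at `λ ∋ ℓ` iff `c′_A(ℓ′) ∈ T_A(λ)`.
[cite: GrossLMS1991, §3 Prop. 3.6–3.7, §4 (4.1)–(4.6), Prop. 6.2] [cite: McCallumLMS1991, §4–§5]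
[cite: HuShuYin2019, §4.1, Prop. 4.6] [cite: Nekovar2007, Prop. 4.9] -/
theorem half_block2_of_level {ω : K} (hω : ω ^ 2 + ω + 1 = 0) (h2 : Module.finrank ℚ K = 2)
    (ι : K →+* ℂ) (hES2 : Nekovar2007.cmPoint_frobeniusCongruence)
    (Dt : ModularParametrizationData (⟨0, 0, 1, 0, -1⟩ : WeierstrassCurve ℚ) 243)
    {p ℓ ℓ' : ℕ} (hp : p.Prime) (hp3 : p % 3 = 1)
    (hKol : ℓ.Prime ∧ ¬ ℓ ∣ (cubeSumCurve (3 * (p : ℚ) ^ 2)).conductorNorm ℤ ∧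
      ¬ ℓ ∣ (cubeSumCurve (p : ℚ)).conductorNorm ℤ ∧ ¬ ((ℓ : ℤ) ∣ NumberField.discr K) ∧ ℓ ≠ 2 ∧
      (Ideal.span {(ℓ : 𝓞 K)}).IsPrime ∧
      FrobEqFrobInfty (cubeSumCurve (3 * (p : ℚ) ^ 2)) K 2 ℓ ∧ FrobEqFrobInfty (cubeSumCurve (p : ℚ)) K 2 ℓ)
    (hKol' : ℓ'.Prime ∧ ¬ ℓ' ∣ (cubeSumCurve (3 * (p : ℚ) ^ 2)).conductorNorm ℤ ∧
      ¬ ℓ' ∣ (cubeSumCurve (p : ℚ)).conductorNorm ℤ ∧ ¬ ((ℓ' : ℤ) ∣ NumberField.discr K) ∧ ℓ' ≠ 2 ∧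
      (Ideal.span {(ℓ' : 𝓞 K)}).IsPrime ∧
      FrobEqFrobInfty (cubeSumCurve (3 * (p : ℚ) ^ 2)) K 2 ℓ' ∧ FrobEqFrobInfty (cubeSumCurve (p : ℚ)) K 2 ℓ')
    (hne : ℓ ≠ ℓ') {m : ℕ} (hm : 9 * p * (ℓ * ℓ') = m)
    (κ : geomPoints ((cubeSumCurve 9).baseChange K) ≃+ geomPoints ((⟨0, 0, 1, 0, -1⟩ : WeierstrassCurve ℚ).baseChange K))
    (hκG : ∀ (g : absoluteGaloisGroup K) (P : geomPoints ((cubeSumCurve 9).baseChange K)), κ (g • P) = g • κ P)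
    (hκ : ∀ {x y : AlgebraicClosure K}
      (h : (((cubeSumCurve 9).baseChange K).baseChange (AlgebraicClosure K)).toAffine.Nonsingular x y),
      ∃ h', κ (.some x y h) = .some (x / 36) ((y - 108) / 216) h')
    {vB vA : AlgebraicClosure K} (hvBc : vB ^ 3 = algebraMap ℚ (AlgebraicClosure K) ((p : ℚ) / 9))
    (hvB : vB ≠ 0) (hvAc : vA ^ 3 = algebraMap ℚ (AlgebraicClosure K) ((p : ℚ) ^ 2 / 3)) (hvA0 : vA ≠ 0)
    (hvB3 : ∀ g : absoluteGaloisGroup K, ((show AlgebraicClosure K ≃ₐ[K] AlgebraicClosure K from g) vB) ^ 3 = vB ^ 3)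
    (hvA3 : ∀ g : absoluteGaloisGroup K, ((show AlgebraicClosure K ≃ₐ[K] AlgebraicClosure K from g) vA) ^ 3 = vA ^ 3)
    {ψB : geomPoints ((cubeSumCurve 9).baseChange K) ≃+ geomPoints ((cubeSumCurve (p : ℚ)).baseChange K)}
    {ψA : geomPoints ((cubeSumCurve 9).baseChange K) ≃+ geomPoints ((cubeSumCurve (3 * (p : ℚ) ^ 2)).baseChange K)}
    (hψB : ∀ {x y : AlgebraicClosure K}
      (h : (((cubeSumCurve 9).baseChange K).baseChange (AlgebraicClosure K)).toAffine.Nonsingular x y),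
      ∃ h', ψB (Affine.Point.some x y h) = Affine.Point.some (vB ^ 2 * x) (vB ^ 3 * y) h')
    (hψA : ∀ {x y : AlgebraicClosure K}
      (h : (((cubeSumCurve 9).baseChange K).baseChange (AlgebraicClosure K)).toAffine.Nonsingular x y),
      ∃ h', ψA (Affine.Point.some x y h) = Affine.Point.some (vA ^ 2 * x) (vA ^ 3 * y) h')
    {ρ : absoluteGaloisGroup K → geomPoints ((cubeSumCurve 9).baseChange K) ≃+ geomPoints ((cubeSumCurve 9).baseChange K)}
    (hρ : ∀ (g : absoluteGaloisGroup K) {x y : AlgebraicClosure K}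
        (h : (((cubeSumCurve 9).baseChange K).baseChange (AlgebraicClosure K)).toAffine.Nonsingular x y),
        ∃ h', ρ g (Affine.Point.some x y h) =
          Affine.Point.some (((show AlgebraicClosure K ≃ₐ[K] AlgebraicClosure K from g) vB / vB) ^ 2 * x) y h')
    (hρρ : ∀ (g : absoluteGaloisGroup K) {x y : AlgebraicClosure K}
        (h : (((cubeSumCurve 9).baseChange K).baseChange (AlgebraicClosure K)).toAffine.Nonsingular x y),
        ∃ h', ρ g (ρ g (Affine.Point.some x y h)) =
          Affine.Point.some (((show AlgebraicClosure K ≃ₐ[K] AlgebraicClosure K from g) vA / vA) ^ 2 * x) y h')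
    (hlawB : ∀ (g : absoluteGaloisGroup K) (P : geomPoints ((cubeSumCurve 9).baseChange K)),
        g • ψB P = ψB (ρ g (g • P)))
    (hlawA : ∀ (g : absoluteGaloisGroup K) (P : geomPoints ((cubeSumCurve 9).baseChange K)),
        g • ψA P = ψA (ρ g (ρ g (g • P))))
    (hρcomm : ∀ (g h : absoluteGaloisGroup K) (P : geomPoints ((cubeSumCurve 9).baseChange K)),
        h • ρ g P = ρ g (h • P))
    (emb₀ : ringClassField K ι (9 * p) →+* AlgebraicClosure K)
    (hemb₀ : ∀ k : K, emb₀ (algebraMap K (ringClassField K ι (9 * p)) k) = algebraMap K (AlgebraicClosure K) k)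
    (N₀ : Subgroup (absoluteGaloisGroup K))
    (hN₀ : ∀ g : absoluteGaloisGroup K, g ∈ N₀ ↔
      ∀ x : ringClassField K ι (9 * p), (show AlgebraicClosure K ≃ₐ[K] AlgebraicClosure K from g) (emb₀ x) = emb₀ x)
    {c₃ cp : ringClassField K ι (9 * p)} (hc₃ : c₃ ^ 3 = 3) (hcp : cp ^ 3 = (p : ringClassField K ι (9 * p)))
    (H : Subgroup (ringClassField K ι (9 * p) ≃ₐ[K] ringClassField K ι (9 * p)))
    (hH : ∀ σ, σ ∈ H ↔ σ c₃ = c₃ ∧ σ cp = cp)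
    [Fintype ((ringClassField K ι (9 * p) ≃ₐ[K] ringClassField K ι (9 * p)) ⧸ H)] [Fintype H]
    (T : (ringClassField K ι (9 * p) ≃ₐ[K] ringClassField K ι (9 * p)) → absoluteGaloisGroup K)
    (hT : ∀ σ (x : ringClassField K ι (9 * p)),
      (show AlgebraicClosure K ≃ₐ[K] AlgebraicClosure K from T σ) (emb₀ x) = emb₀ (σ x))
    (t : ((ringClassField K ι (9 * p) ≃ₐ[K] ringClassField K ι (9 * p)) ⧸ H) × H → absoluteGaloisGroup K)
    (ht' : ∀ q h, t (q, h) = T (Quotient.out q) * T (h : _))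
    -- the involution datum at the bottom (TOWER FIXING at `n = 1`; displayed): `s ∈ H`, `s² = 1`, a half `H′`
    (s : H) (hs2 : s * s = 1) (H' : Finset H) (hH' : ∀ h : H, Xor (h ∈ H') (h * s ∈ H'))
    {y₁ : ((⟨0, 0, 1, 0, -1⟩ : WeierstrassCurve ℚ).baseChange (ringClassField K ι (9 * p))).toAffine.Point}
    (hy₁ : Affine.Point.map (W' := (⟨0, 0, 1, 0, -1⟩ : WeierstrassCurve ℚ)) (ringClassField K ι (9 * p)).subtype.toRatAlgHom y₁ =
      Dt.φ (heegnerTau (81 * ((p : ℤ) ^ 2 + 4 * p + 16), -(9 * (4 * (p : ℤ) ^ 2 + 17 * p + 72)),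
        4 * (p : ℤ) ^ 2 + 18 * p + 81)))
    (hle₀' : ringClassField K ι (9 * p) ≤ ringClassField K ι (9 * p * ℓ'))
    (emb' : ringClassField K ι (9 * p * ℓ') →+* AlgebraicClosure K)
    (hemb' : ∀ k : K, emb' (algebraMap K (ringClassField K ι (9 * p * ℓ')) k) = algebraMap K (AlgebraicClosure K) k)
    (hcoh₀' : ∀ x : ringClassField K ι (9 * p), emb' (RingClassField.inclusion ι hle₀' x) = emb₀ x)
    (ιe' : letI : DecidableEq (ringClassField K ι (9 * p * ℓ')) := fun a b ↦ Classical.propDecidable (a = b)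
      ((⟨0, 0, 1, 0, -1⟩ : WeierstrassCurve ℚ).baseChange (ringClassField K ι (9 * p * ℓ'))).toAffine.Point →+ geomPoints ((⟨0, 0, 1, 0, -1⟩ : WeierstrassCurve ℚ).baseChange K))
    (hιe' : ∀ P, ιe' P = Affine.Point.map (W' := (⟨0, 0, 1, 0, -1⟩ : WeierstrassCurve ℚ)) emb'.toRatAlgHom P)
    (N' : Subgroup (absoluteGaloisGroup K))
    (hN'' : ∀ g : absoluteGaloisGroup K, g ∈ N' ↔
      ∀ x : ringClassField K ι (9 * p * ℓ'), (show AlgebraicClosure K ≃ₐ[K] AlgebraicClosure K from g) (emb' x) = emb' x)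
    {σℓ' : ringClassField K ι (9 * p * ℓ') ≃ₐ[ℚ] ringClassField K ι (9 * p * ℓ')}
    (hσℓ' : Subgroup.zpowers σℓ' = ringClassGalOver ι (9 * p * ℓ') (9 * p))
    {yℓ'₀ : ((⟨0, 0, 1, 0, -1⟩ : WeierstrassCurve ℚ).baseChange (ringClassField K ι (9 * p * ℓ'))).toAffine.Point}
    (hyℓ'₀ : Affine.Point.map (W' := (⟨0, 0, 1, 0, -1⟩ : WeierstrassCurve ℚ)) (ringClassField K ι (9 * p * ℓ')).subtype.toRatAlgHom yℓ'₀ =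
      Dt.φ (heegnerTau ((ℓ' : ℤ) ^ 2 * (81 * ((p : ℤ) ^ 2 + 4 * p + 16)),
        (ℓ' : ℤ) * (-(9 * (4 * (p : ℤ) ^ 2 + 17 * p + 72))), 4 * (p : ℤ) ^ 2 + 18 * p + 81)))
    {hdivA : ∀ P : geomPoints ((cubeSumCurve (3 * (p : ℚ) ^ 2)).baseChange K),
      ∃ R : geomPoints ((cubeSumCurve (3 * (p : ℚ) ^ 2)).baseChange K), ((2 : ℕ) : ℤ) • R = P}
    {hdivB : ∀ P : geomPoints ((cubeSumCurve (p : ℚ)).baseChange K),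
      ∃ R : geomPoints ((cubeSumCurve (p : ℚ)).baseChange K), ((2 : ℕ) : ℤ) • R = P}
    (hA₁' : IsAdmissible (absoluteGaloisGroup K)
      ((FixedPoints.addSubgroup N' (geomPoints ((cubeSumCurve 9).baseChange K))).map ψA.toAddMonoidHom) ((2 : ℕ) : ℤ))
    (hQN' : (∑ i : ((ringClassField K ι (9 * p) ≃ₐ[K] ringClassField K ι (9 * p)) ⧸ H) × H', ρ (t (i.1, (i.2 : H))) (ρ (t (i.1, (i.2 : H))) (t (i.1, (i.2 : H)) •
        κ.symm (ιe' (KolyvaginOperator.derivOp (pointGalHom (⟨0, 0, 1, 0, -1⟩ : WeierstrassCurve ℚ) (ringClassField K ι (9 * p * ℓ'))) σℓ' ℓ' yℓ'₀))))) ∈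
      FixedPoints.addSubgroup N' (geomPoints ((cubeSumCurve 9).baseChange K)))
    (hP₁' : ψA (∑ i : ((ringClassField K ι (9 * p) ≃ₐ[K] ringClassField K ι (9 * p)) ⧸ H) × H', ρ (t (i.1, (i.2 : H))) (ρ (t (i.1, (i.2 : H))) (t (i.1, (i.2 : H)) •
        κ.symm (ιe' (KolyvaginOperator.derivOp (pointGalHom (⟨0, 0, 1, 0, -1⟩ : WeierstrassCurve ℚ) (ringClassField K ι (9 * p * ℓ'))) σℓ' ℓ' yℓ'₀))))) ∈
      invPoints (absoluteGaloisGroup K)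
        ((FixedPoints.addSubgroup N' (geomPoints ((cubeSumCurve 9).baseChange K))).map ψA.toAddMonoidHom) ((2 : ℕ) : ℤ))
    (hN'vA : ∀ h ∈ N', (show AlgebraicClosure K ≃ₐ[K] AlgebraicClosure K from h) vA = vA)
    (hle'2 : ringClassField K ι (9 * p * ℓ') ≤ ringClassField K ι m)
    (hle₀2 : ringClassField K ι (9 * p) ≤ ringClassField K ι m)
    (emb : ringClassField K ι m →+* AlgebraicClosure K)
    (hemb : ∀ k : K, emb (algebraMap K (ringClassField K ι m) k) = algebraMap K (AlgebraicClosure K) k)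
    (hcoh'2 : ∀ x : ringClassField K ι (9 * p * ℓ'), emb (RingClassField.inclusion ι hle'2 x) = emb' x)
    (hcoh₀2 : ∀ x : ringClassField K ι (9 * p), emb (RingClassField.inclusion ι hle₀2 x) = emb₀ x)
    (ιe : letI : DecidableEq (ringClassField K ι m) := fun a b ↦ Classical.propDecidable (a = b)
      ((⟨0, 0, 1, 0, -1⟩ : WeierstrassCurve ℚ).baseChange (ringClassField K ι m)).toAffine.Point →+ geomPoints ((⟨0, 0, 1, 0, -1⟩ : WeierstrassCurve ℚ).baseChange K))
    (hιe : ∀ P, ιe P = Affine.Point.map (W' := (⟨0, 0, 1, 0, -1⟩ : WeierstrassCurve ℚ)) emb.toRatAlgHom P)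
    (N : Subgroup (absoluteGaloisGroup K))
    (hN : ∀ g : absoluteGaloisGroup K, g ∈ N ↔
      ∀ x : ringClassField K ι m, (show AlgebraicClosure K ≃ₐ[K] AlgebraicClosure K from g) (emb x) = emb x)
    {σ σ' : ringClassField K ι m ≃ₐ[ℚ] ringClassField K ι m}
    (hσ : Subgroup.zpowers σ = ringClassGalOver ι m (9 * p * ℓ'))
    (hσ' : Subgroup.zpowers σ' = ringClassGalOver ι m (9 * p * ℓ))
    (hσ'res : ∀ x : ringClassField K ι (9 * p * ℓ'),
      σ' (RingClassField.inclusion ι hle'2 x) = RingClassField.inclusion ι hle'2 (σℓ' x))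
    {y yℓ : ((⟨0, 0, 1, 0, -1⟩ : WeierstrassCurve ℚ).baseChange (ringClassField K ι m)).toAffine.Point}
    (hy : Affine.Point.map (W' := (⟨0, 0, 1, 0, -1⟩ : WeierstrassCurve ℚ)) (ringClassField K ι m).subtype.toRatAlgHom y =
      Dt.φ (heegnerTau (((ℓ * ℓ' : ℕ) : ℤ) ^ 2 * (81 * ((p : ℤ) ^ 2 + 4 * p + 16)),
        ((ℓ * ℓ' : ℕ) : ℤ) * (-(9 * (4 * (p : ℤ) ^ 2 + 17 * p + 72))), 4 * (p : ℤ) ^ 2 + 18 * p + 81)))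
    (hyℓ : Affine.Point.map (W' := (⟨0, 0, 1, 0, -1⟩ : WeierstrassCurve ℚ)) (ringClassField K ι m).subtype.toRatAlgHom yℓ =
      Dt.φ (heegnerTau ((ℓ : ℤ) ^ 2 * (81 * ((p : ℤ) ^ 2 + 4 * p + 16)),
        (ℓ : ℤ) * (-(9 * (4 * (p : ℤ) ^ 2 + 17 * p + 72))), 4 * (p : ℤ) ^ 2 + 18 * p + 81)))
    -- THE TOWER FIXING at `n = ℓℓ′` (W2-b; displayed, not proved): a lift `φ` of `s` to `K[m]` fixing `y`
    (φ : ringClassField K ι m ≃ₐ[K] ringClassField K ι m)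
    (hφs : ∀ x : ringClassField K ι (9 * p),
      φ (RingClassField.inclusion ι hle₀2 x) =
        RingClassField.inclusion ι hle₀2 ((s : ringClassField K ι (9 * p) ≃ₐ[K] ringClassField K ι (9 * p)) x))
    (hφy : pointGalHom (⟨0, 0, 1, 0, -1⟩ : WeierstrassCurve ℚ) (ringClassField K ι m) (φ.restrictScalars ℚ) y = y) :
    ∃ (hA₁ : IsAdmissible (absoluteGaloisGroup K)
        ((FixedPoints.addSubgroup N (geomPoints ((cubeSumCurve 9).baseChange K))).map ψB.toAddMonoidHom) ((2 : ℕ) : ℤ))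
      (_ : (∑ i : ((ringClassField K ι (9 * p) ≃ₐ[K] ringClassField K ι (9 * p)) ⧸ H) × H', ρ (t (i.1, (i.2 : H))) (t (i.1, (i.2 : H)) • κ.symm (ιe (KolyvaginOperator.derivOp (pointGalHom (⟨0, 0, 1, 0, -1⟩ : WeierstrassCurve ℚ) (ringClassField K ι m)) σ ℓ
          (KolyvaginOperator.derivOp (pointGalHom (⟨0, 0, 1, 0, -1⟩ : WeierstrassCurve ℚ) (ringClassField K ι m)) σ' ℓ' y))))) ∈
        FixedPoints.addSubgroup N (geomPoints ((cubeSumCurve 9).baseChange K)))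
      (hP₁ : ψB (∑ i : ((ringClassField K ι (9 * p) ≃ₐ[K] ringClassField K ι (9 * p)) ⧸ H) × H', ρ (t (i.1, (i.2 : H))) (t (i.1, (i.2 : H)) • κ.symm (ιe (KolyvaginOperator.derivOp (pointGalHom (⟨0, 0, 1, 0, -1⟩ : WeierstrassCurve ℚ) (ringClassField K ι m)) σ ℓ
          (KolyvaginOperator.derivOp (pointGalHom (⟨0, 0, 1, 0, -1⟩ : WeierstrassCurve ℚ) (ringClassField K ι m)) σ' ℓ' y))))) ∈
        invPoints (absoluteGaloisGroup K)
          ((FixedPoints.addSubgroup N (geomPoints ((cubeSumCurve 9).baseChange K))).map ψB.toAddMonoidHom) ((2 : ℕ) : ℤ)),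
      (∀ h ∈ N, (show AlgebraicClosure K ≃ₐ[K] AlgebraicClosure K from h) vB = vB) ∧
      ∀ (v : HeightOneSpectrum (𝓞 K)), (ℓ : 𝓞 K) ∈ v.asIdeal →
        (kolyvaginClass ((cubeSumCurve (p : ℚ)).baseChange K) ((2 : ℕ) : ℤ) hdivB hA₁
            (ψB (∑ i : ((ringClassField K ι (9 * p) ≃ₐ[K] ringClassField K ι (9 * p)) ⧸ H) × H', ρ (t (i.1, (i.2 : H))) (t (i.1, (i.2 : H)) • κ.symm (ιe (KolyvaginOperator.derivOp (pointGalHom (⟨0, 0, 1, 0, -1⟩ : WeierstrassCurve ℚ) (ringClassField K ι m)) σ ℓ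
              (KolyvaginOperator.derivOp (pointGalHom (⟨0, 0, 1, 0, -1⟩ : WeierstrassCurve ℚ) (ringClassField K ι m)) σ' ℓ' y)))))) hP₁ ∈
            selmerLocalKer ((cubeSumCurve (p : ℚ)).baseChange K) (v.adicCompletion K) ((2 : ℕ) : ℤ) ↔
          kolyvaginClass ((cubeSumCurve (3 * (p : ℚ) ^ 2)).baseChange K) ((2 : ℕ) : ℤ) hdivA hA₁'
              (ψA (∑ i : ((ringClassField K ι (9 * p) ≃ₐ[K] ringClassField K ι (9 * p)) ⧸ H) × H', ρ (t (i.1, (i.2 : H))) (ρ (t (i.1, (i.2 : H))) (t (i.1, (i.2 : H)) •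
                κ.symm (ιe' (KolyvaginOperator.derivOp (pointGalHom (⟨0, 0, 1, 0, -1⟩ : WeierstrassCurve ℚ) (ringClassField K ι (9 * p * ℓ'))) σℓ' ℓ' yℓ'₀)))))) hP₁' ∈
            ((cubeSumCurve (3 * (p : ℚ) ^ 2)).baseChange K).torsionLocalKer (v.adicCompletion K) ((2 : ℕ) : ℤ)) := by
  subst hm
  obtain ⟨hℓ, hℓA, hℓB, hℓdK, hℓ2, hinert, hFrobA, hFrobB⟩ := hKol
  obtain ⟨hℓ', hℓ'A, hℓ'B, hℓ'dK, hℓ'2, hinert', hFrobA', hFrobB'⟩ := hKol'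
  haveI : Fact ℓ.Prime := ⟨hℓ⟩
  obtain ⟨hℓ3, hℓp⟩ := mod_three_eq_two_of_clause hω h2 hp hp3 hℓ hℓdK hFrobB
  obtain ⟨hℓ'3, hℓ'p⟩ := mod_three_eq_two_of_clause hω h2 hp hp3 hℓ' hℓ'dK hFrobB'
  have hK := JZero.isImaginaryQuadratic_of_sq_add_self_add_one hω h2
  have hdK := JZero.discr_eq_neg_three_of_sq_add_self_add_one hω h2
  have hp0 : p ≠ 0 := hp.ne_zero
  have hp2 : p ≠ 2 := by rintro rfl; norm_num at hp3
  have hℓ3ne : ℓ ≠ 3 := by rintro rfl; norm_num at hℓ3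
  have hℓ'3ne : ℓ' ≠ 3 := by rintro rfl; norm_num at hℓ'3
  have hp_odd : Odd p := hp.eq_two_or_odd'.resolve_left hp2
  have hℓ_odd : Odd ℓ := hℓ.eq_two_or_odd'.resolve_left hℓ2
  have hℓ'_odd : Odd ℓ' := hℓ'.eq_two_or_odd'.resolve_left hℓ'2
  haveI := isElliptic_sylvesterNineMinimal
  haveI := isGloballyMinimal_sylvesterNineMinimal
  have hΔ := not_dvd_minimalDiscriminantInt_sylvesterNineMinimal hℓ hℓ3ne
  have hΔ' := not_dvd_minimalDiscriminantInt_sylvesterNineMinimal hℓ' hℓ'3ne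
  have hMa : ((2 ^ 1 : ℕ) : ℤ) ∣ (⟨0, 0, 1, 0, -1⟩ : WeierstrassCurve ℚ).LFunction ℓ := by
    rw [JZero.lFunction_eq_zero_of_j_eq_zero_of_mod_three_eq_two _ j_sylvesterNineMinimal hℓ hℓ3 hℓ2 hΔ]
    exact dvd_zero _
  have hMa' : ((2 ^ 1 : ℕ) : ℤ) ∣ (⟨0, 0, 1, 0, -1⟩ : WeierstrassCurve ℚ).LFunction ℓ' := by
    rw [JZero.lFunction_eq_zero_of_j_eq_zero_of_mod_three_eq_two _ j_sylvesterNineMinimal hℓ' hℓ'3 hℓ'2 hΔ']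
    exact dvd_zero _
  have hMℓ : 2 ^ 1 ∣ ℓ + 1 := by rw [pow_one]; exact hℓ_odd.add_one.two_dvd
  have hMℓ' : 2 ^ 1 ∣ ℓ' + 1 := by rw [pow_one]; exact hℓ'_odd.add_one.two_dvd
  have hf : 9 * p ≠ 0 := mul_ne_zero (by norm_num) hp0
  have hm0' : 9 * p * ℓ' ≠ 0 := mul_ne_zero hf hℓ'.ne_zero
  have hn0 : 9 * p * (ℓ * ℓ') ≠ 0 := mul_ne_zero hf (mul_ne_zero hℓ.ne_zero hℓ'.ne_zero)
  have hℓ9p' : ¬ ℓ ∣ 9 * p * ℓ' := fun h ↦ by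
    rcases (Nat.Prime.dvd_mul hℓ).mp h with h1 | h2'
    · rcases (Nat.Prime.dvd_mul hℓ).mp h1 with h9 | hp'
      · exact hℓ3ne ((Nat.prime_dvd_prime_iff_eq hℓ Nat.prime_three).mp
          (hℓ.dvd_of_dvd_pow (by norm_num at h9 ⊢; exact h9 : ℓ ∣ 3 ^ 2)))
      · exact hℓp hp'
    · exact hne ((Nat.prime_dvd_prime_iff_eq hℓ hℓ').mp h2')
  haveI := (finiteDimensional_and_isGalois_ringClassField hK ι hn0).2
  haveI := (finiteDimensional_and_isGalois_ringClassField hK ι hm0').2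
  have hN₀2 := mem_iff_forall_mem_nine_mul ι hle₀2 emb₀ emb hcoh₀2 hN₀
  set yℓ' : ((⟨0, 0, 1, 0, -1⟩ : WeierstrassCurve ℚ).baseChange (ringClassField K ι (9 * p * (ℓ * ℓ')))).toAffine.Point :=
    Affine.Point.map (W' := (⟨0, 0, 1, 0, -1⟩ : WeierstrassCurve ℚ)) ((RingClassField.inclusion ι hle'2).restrictScalars ℚ) yℓ'₀ with hyℓ'def
  have hyℓ' : Affine.Point.map (W' := (⟨0, 0, 1, 0, -1⟩ : WeierstrassCurve ℚ)) (ringClassField K ι (9 * p * (ℓ * ℓ'))).subtype.toRatAlgHom yℓ' =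
      Dt.φ (heegnerTau ((ℓ' : ℤ) ^ 2 * (81 * ((p : ℤ) ^ 2 + 4 * p + 16)),
        (ℓ' : ℤ) * (-(9 * (4 * (p : ℤ) ^ 2 + 17 * p + 72))), 4 * (p : ℤ) ^ 2 + 18 * p + 81)) := by
    rw [← hyℓ'₀, hyℓ'def]
    exact map_toRatAlgHom_map_inclusion (W := (⟨0, 0, 1, 0, -1⟩ : WeierstrassCurve ℚ)) ι hle'2 (ringClassField K ι (9 * p * (ℓ * ℓ'))).subtype
      (ringClassField K ι (9 * p * ℓ')).subtype (fun x' ↦ RingClassField.coe_inclusion ι hle'2 x') yℓ'₀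
  have hPm : ιe (KolyvaginOperator.derivOp (pointGalHom (⟨0, 0, 1, 0, -1⟩ : WeierstrassCurve ℚ) (ringClassField K ι (9 * p * (ℓ * ℓ')))) σ' ℓ' yℓ') =
      ιe' (KolyvaginOperator.derivOp (pointGalHom (⟨0, 0, 1, 0, -1⟩ : WeierstrassCurve ℚ) (ringClassField K ι (9 * p * ℓ'))) σℓ' ℓ' yℓ'₀) := by
    rw [hyℓ'def, derivOp_map_inclusion ι hle'2 hσ'res ℓ' yℓ'₀, hιe, hιe']
    exact map_toRatAlgHom_map_inclusion (W := (⟨0, 0, 1, 0, -1⟩ : WeierstrassCurve ℚ)) ι hle'2 emb emb' hcoh'2 _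
  have hPnN := mem_fixedPoints_symm_of_equivariant κ hκG N
    (map_emb_mem_fixedPoints (⟨0, 0, 1, 0, -1⟩ : WeierstrassCurve ℚ) ι emb ιe hιe N hN
      (KolyvaginOperator.derivOp (pointGalHom (⟨0, 0, 1, 0, -1⟩ : WeierstrassCurve ℚ) (ringClassField K ι (9 * p * (ℓ * ℓ')))) σ ℓ
        (KolyvaginOperator.derivOp (pointGalHom (⟨0, 0, 1, 0, -1⟩ : WeierstrassCurve ℚ) (ringClassField K ι (9 * p * (ℓ * ℓ')))) σ' ℓ' y)))
  -- the HALF pair package (#S7): `hQN`, `hP₁B`; admissibility at the level `m`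
  haveI hNn : N.Normal := normal_of_mem_iff emb hemb N hN
  have hNN₀ : N ≤ N₀ := le_of_mem_iff_of_mem_iff_forall emb hN hN₀2
  have hNvB : ∀ h ∈ N, (show AlgebraicClosure K ≃ₐ[K] AlgebraicClosure K from h) vB = vB := fun h hh ↦
    apply_vB_eq_of_mem_fixer hω ι hp0 hvBc emb₀ N₀ hN₀ hc₃ hcp h (hNN₀ hh)
  have h6 := pow_three_ne_six_of_fix_sylvester_prime hK hdK ι hp_odd (hℓ_odd.mul hℓ'_odd) emb hemb N hN
  have hρρ' : ∀ (g : absoluteGaloisGroup K) {x y : AlgebraicClosure K}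
      (h : (((cubeSumCurve 9).baseChange K).baseChange (AlgebraicClosure K)).toAffine.Nonsingular x y),
      ∃ h', (fun g ↦ (ρ g).trans (ρ g)) g (Affine.Point.some x y h) =
        Affine.Point.some (((show AlgebraicClosure K ≃ₐ[K] AlgebraicClosure K from g) vA / vA) ^ 2 * x)
          y h' := fun g x y h ↦ hρρ g h
  have hlawA' : ∀ (g : absoluteGaloisGroup K) (P : geomPoints ((cubeSumCurve 9).baseChange K)),
      g • ψA P = ψA ((fun g ↦ (ρ g).trans (ρ g)) g (g • P)) := fun g P ↦ hlawA g P
  have hA₁B := isAdmissible_map_fixedPoints_cubeSumCurve_nine K hω hvB hvB3 hρ hlawB N h6 1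
  have hA₂A := isAdmissible_map_fixedPoints_cubeSumCurve_nine K hω hvA0 hvA3 hρρ' hlawA' N h6 1
  obtain ⟨hQNhalf, hP₁B⟩ := half_chiComponentB_pair_mem_invPoints hω h2 ι Dt hp hp3
    ⟨hℓ, hℓA, hℓB, hℓdK, hℓ2, hinert, hFrobA, hFrobB⟩ ⟨hℓ', hℓ'A, hℓ'B, hℓ'dK, hℓ'2, hinert', hFrobA', hFrobB'⟩ hne
    κ hκG hvBc hvB hvAc hvB3 hρ hlawB emb₀ hemb₀ N₀ hN₀ hc₃ hcp H hH T hT t ht' s hs2 H' hH' hle₀2 emb hemb hcoh₀2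
    ιe hιe N hN hσ hσ' hy hyℓ hyℓ' φ hφs hφy
  have hN2le : N ≤ N' := fun g hg ↦ (hN'' g).mpr fun x ↦ by rw [← hcoh'2]; exact (hN g).mp hg _
  have hmapmonoA : (FixedPoints.addSubgroup N' (geomPoints ((cubeSumCurve 9).baseChange K))).map ψA.toAddMonoidHom ≤
      (FixedPoints.addSubgroup N (geomPoints ((cubeSumCurve 9).baseChange K))).map ψA.toAddMonoidHom := by
    refine AddSubgroup.map_mono fun a ha ↦ ?_
    rw [JZero.mem_fixedPoints_iff] at ha ⊢
    exact fun g hg ↦ ha g (hN2le hg)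
  -- the invariance of the `ℓ′`-class read at the pair level, TRANSPORTED from `hP₁'` (no second tower fixing)
  have hP₂A : ψA (∑ i : ((ringClassField K ι (9 * p) ≃ₐ[K] ringClassField K ι (9 * p)) ⧸ H) × H', ρ (t (i.1, (i.2 : H))) (ρ (t (i.1, (i.2 : H))) (t (i.1, (i.2 : H)) • κ.symm (ιe (KolyvaginOperator.derivOp
        (pointGalHom (⟨0, 0, 1, 0, -1⟩ : WeierstrassCurve ℚ) (ringClassField K ι (9 * p * (ℓ * ℓ')))) σ' ℓ' yℓ'))))) ∈
      invPoints (absoluteGaloisGroup K)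
        ((FixedPoints.addSubgroup N (geomPoints ((cubeSumCurve 9).baseChange K))).map ψA.toAddMonoidHom)
        ((2 : ℕ) : ℤ) := by
    simp only [hPm]
    exact ⟨hmapmonoA hP₁'.1, fun g ↦ by
      obtain ⟨R, hR, e⟩ := hP₁'.2 g
      exact ⟨R, hmapmonoA hR, e⟩⟩
  have hA₁ : IsAdmissible (absoluteGaloisGroup K)
      ((FixedPoints.addSubgroup N (geomPoints ((cubeSumCurve 9).baseChange K))).map ψB.toAddMonoidHom)
      ((2 : ℕ) : ℤ) := hA₁B
  have hA₂ : IsAdmissible (absoluteGaloisGroup K)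
      ((FixedPoints.addSubgroup N (geomPoints ((cubeSumCurve 9).baseChange K))).map ψA.toAddMonoidHom)
      ((2 : ℕ) : ℤ) := hA₂A
  have hP₁ : ψB (∑ i : ((ringClassField K ι (9 * p) ≃ₐ[K] ringClassField K ι (9 * p)) ⧸ H) × H', ρ (t (i.1, (i.2 : H))) (t (i.1, (i.2 : H)) • κ.symm (ιe (KolyvaginOperator.derivOp
        (pointGalHom (⟨0, 0, 1, 0, -1⟩ : WeierstrassCurve ℚ) (ringClassField K ι (9 * p * (ℓ * ℓ')))) σ ℓ
        (KolyvaginOperator.derivOp (pointGalHom (⟨0, 0, 1, 0, -1⟩ : WeierstrassCurve ℚ) (ringClassField K ι (9 * p * (ℓ * ℓ')))) σ' ℓ' y))))) ∈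
      invPoints (absoluteGaloisGroup K)
        ((FixedPoints.addSubgroup N (geomPoints ((cubeSumCurve 9).baseChange K))).map ψB.toAddMonoidHom)
        ((2 : ℕ) : ℤ) := hP₁B
  have hP₂ : ψA (∑ i : ((ringClassField K ι (9 * p) ≃ₐ[K] ringClassField K ι (9 * p)) ⧸ H) × H', ρ (t (i.1, (i.2 : H))) (ρ (t (i.1, (i.2 : H))) (t (i.1, (i.2 : H)) • κ.symm (ιe (KolyvaginOperator.derivOp
        (pointGalHom (⟨0, 0, 1, 0, -1⟩ : WeierstrassCurve ℚ) (ringClassField K ι (9 * p * (ℓ * ℓ')))) σ' ℓ' yℓ'))))) ∈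
      invPoints (absoluteGaloisGroup K)
        ((FixedPoints.addSubgroup N (geomPoints ((cubeSumCurve 9).baseChange K))).map ψA.toAddMonoidHom)
        ((2 : ℕ) : ℤ) := hP₂A
  haveI : N.Normal := hNn
  have hQN := hQNhalf
  have hκ' : ∀ {x y : AlgebraicClosure K}
      (h : (((cubeSumCurve 9).baseChange K).baseChange (AlgebraicClosure K)).toAffine.Nonsingular x y),
      ∃ h', κ (.some x y h) = .some ((36 : AlgebraicClosure K)⁻¹ * x)
        ((216 : AlgebraicClosure K)⁻¹ * y + -(1 / 2)) h' := by
    intro x y h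
    obtain ⟨h', e⟩ := hκ h
    have ex : x / 36 = (36 : AlgebraicClosure K)⁻¹ * x := by ring
    have ey : (y - 108) / 216 = (216 : AlgebraicClosure K)⁻¹ * y + -(1 / 2) := by ring
    exact ⟨ex ▸ ey ▸ h', e.trans (Affine.Point.some_eq_some_of_eq ex ey)⟩
  have hKolA : IsKolyvaginPrime ((cubeSumCurve (3 * (p : ℚ) ^ 2)).conductorNorm ℤ)
      (cubeSumCurve (3 * (p : ℚ) ^ 2)) K 2 ℓ := ⟨hℓ, hℓA, hℓdK, hℓ2, hinert, hFrobA⟩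
  have hPmFrob : ∀ (v : HeightOneSpectrum (𝓞 K)), (ℓ : 𝓞 K) ∈ v.asIdeal →
      ∀ 𝔓 ∈ v.primesAbove, ∀ F : absoluteGaloisGroup K, IsArithFrobAt (𝓞 K) F 𝔓 →
        F • κ.symm (ιe (KolyvaginOperator.derivOp
            (pointGalHom (⟨0, 0, 1, 0, -1⟩ : WeierstrassCurve ℚ) (ringClassField K ι (9 * p * (ℓ * ℓ')))) σ' ℓ' yℓ')) =
          κ.symm (ιe (KolyvaginOperator.derivOp
            (pointGalHom (⟨0, 0, 1, 0, -1⟩ : WeierstrassCurve ℚ) (ringClassField K ι (9 * p * (ℓ * ℓ')))) σ' ℓ' yℓ')) := by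
    intro v hv 𝔓 h𝔓 F hF
    have hvpl : v = hKolA.place := hKolA.mem_iff.mp hv
    have hfixF : ∀ x : ringClassField K ι (9 * p * ℓ'),
        (show AlgebraicClosure K ≃ₐ[K] AlgebraicClosure K from F) (emb' x) = emb' x := fun x ↦
      IsKolyvaginPrime.smul_algHom_ringClassField_eq_self hKolA hK ι hm0' hℓ9p'
        ({ emb' with commutes' := hemb' } : ringClassField K ι (9 * p * ℓ') →ₐ[K] AlgebraicClosure K)
        (by rw [← hvpl]; exact h𝔓) hF x
    apply κ.injective
    rw [hκG, κ.apply_symm_apply, hPm]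
    exact smul_embPoints_eq_self (⟨0, 0, 1, 0, -1⟩ : WeierstrassCurve ℚ) emb' ιe' hιe' F hfixF _
  have hcls : kolyvaginClass ((cubeSumCurve (3 * (p : ℚ) ^ 2)).baseChange K) ((2 : ℕ) : ℤ) hdivA hA₂
      (ψA (∑ i : ((ringClassField K ι (9 * p) ≃ₐ[K] ringClassField K ι (9 * p)) ⧸ H) × H', ρ (t (i.1, (i.2 : H))) (ρ (t (i.1, (i.2 : H))) (t (i.1, (i.2 : H)) • κ.symm (ιe (KolyvaginOperator.derivOp
        (pointGalHom (⟨0, 0, 1, 0, -1⟩ : WeierstrassCurve ℚ) (ringClassField K ι (9 * p * (ℓ * ℓ')))) σ' ℓ' yℓ')))))) hP₂ =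
      kolyvaginClass ((cubeSumCurve (3 * (p : ℚ) ^ 2)).baseChange K) ((2 : ℕ) : ℤ) hdivA hA₁'
        (ψA (∑ i : ((ringClassField K ι (9 * p) ≃ₐ[K] ringClassField K ι (9 * p)) ⧸ H) × H', ρ (t (i.1, (i.2 : H))) (ρ (t (i.1, (i.2 : H))) (t (i.1, (i.2 : H)) •
          κ.symm (ιe' (KolyvaginOperator.derivOp (pointGalHom (⟨0, 0, 1, 0, -1⟩ : WeierstrassCurve ℚ) (ringClassField K ι (9 * p * ℓ'))) σℓ' ℓ' yℓ'₀))))))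
        hP₁' := by
    have key : ∀ {P : geomPoints ((cubeSumCurve (3 * (p : ℚ) ^ 2)).baseChange K)}
        (hP : P ∈ invPoints (absoluteGaloisGroup K)
          ((FixedPoints.addSubgroup N (geomPoints ((cubeSumCurve 9).baseChange K))).map ψA.toAddMonoidHom)
          ((2 : ℕ) : ℤ))
        (e : P = ψA (∑ i : ((ringClassField K ι (9 * p) ≃ₐ[K] ringClassField K ι (9 * p)) ⧸ H) × H', ρ (t (i.1, (i.2 : H))) (ρ (t (i.1, (i.2 : H))) (t (i.1, (i.2 : H)) •
          κ.symm (ιe' (KolyvaginOperator.derivOp (pointGalHom (⟨0, 0, 1, 0, -1⟩ : WeierstrassCurve ℚ) (ringClassField K ι (9 * p * ℓ'))) σℓ' ℓ' yℓ'₀)))))),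
        kolyvaginClass ((cubeSumCurve (3 * (p : ℚ) ^ 2)).baseChange K) ((2 : ℕ) : ℤ) hdivA hA₂ P hP =
          kolyvaginClass ((cubeSumCurve (3 * (p : ℚ) ^ 2)).baseChange K) ((2 : ℕ) : ℤ) hdivA hA₁' _ hP₁' := by
      intro P hP e
      subst e
      exact (kolyvaginClass_mono hA₁' hA₂ hmapmonoA hP₁' hP).symm
    exact key hP₂ (by rw [hPm])
  have hsel₂ : ∀ (v : HeightOneSpectrum (𝓞 K)), (ℓ : 𝓞 K) ∈ v.asIdeal →
      kolyvaginClass ((cubeSumCurve (3 * (p : ℚ) ^ 2)).baseChange K) ((2 : ℕ) : ℤ) hdivA hA₂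
        (ψA (∑ i : ((ringClassField K ι (9 * p) ≃ₐ[K] ringClassField K ι (9 * p)) ⧸ H) × H', ρ (t (i.1, (i.2 : H))) (ρ (t (i.1, (i.2 : H))) (t (i.1, (i.2 : H)) • κ.symm (ιe (KolyvaginOperator.derivOp
          (pointGalHom (⟨0, 0, 1, 0, -1⟩ : WeierstrassCurve ℚ) (ringClassField K ι (9 * p * (ℓ * ℓ')))) σ' ℓ' yℓ')))))) hP₂ ∈
        selmerLocalKer ((cubeSumCurve (3 * (p : ℚ) ^ 2)).baseChange K) (v.adicCompletion K) ((2 : ℕ) : ℤ) := by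
    intro v hv
    rw [hcls]
    have h3v : ((3 : ℕ) : 𝓞 K) ∉ v.asIdeal := not_natCast_mem_of_prime_ne hℓ Nat.prime_three hℓ3ne v hv
    have hpv : ((p : ℕ) : 𝓞 K) ∉ v.asIdeal :=
      not_natCast_mem_of_prime_ne hℓ hp (fun h ↦ hℓp (h ▸ dvd_rfl)) v hv
    have hℓ'v : ((ℓ' : ℕ) : 𝓞 K) ∉ v.asIdeal := not_natCast_mem_of_prime_ne hℓ hℓ' hne v hv
    have hmv : ((9 * p * ℓ' : ℕ) : 𝓞 K) ∉ v.asIdeal := by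
      intro h
      push_cast at h
      rcases v.isPrime.mem_or_mem h with h1 | h2'
      · rcases v.isPrime.mem_or_mem h1 with h9 | hp'
        · have h9' : ((3 : ℕ) : 𝓞 K) * ((3 : ℕ) : 𝓞 K) ∈ v.asIdeal := by push_cast; norm_num; exact h9
          rcases v.isPrime.mem_or_mem h9' with h3 | h3 <;> exact h3v h3
        · exact hpv (by exact_mod_cast hp')
      · exact hℓ'v (by exact_mod_cast h2')
    exact kolyvaginClass_cmFrame_cubeSumCurve_three_mul_sq_mem_selmerLocalKer hK ι hm0' emb' hemb' N' hN'' hp hp2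
      hψA hN'vA hA₁' hQN' hP₁' v h3v hpv hmv
  have hES : ∀ (φ₀ : absoluteGaloisGroup (ZMod ℓ)), (∀ x : AlgebraicClosure (ZMod ℓ), φ₀ • x = x ^ ℓ) →
      ∀ (g : absoluteGaloisGroup K)
        (γ : ringClassField K ι (9 * p * (ℓ * ℓ')) ≃ₐ[ℚ] ringClassField K ι (9 * p * (ℓ * ℓ'))),
        geomReduction hΔ ((RatClosure.pointsEquiv (K := K) (⟨0, 0, 1, 0, -1⟩ : WeierstrassCurve ℚ)).symm
            (g • ιe (pointGalHom (⟨0, 0, 1, 0, -1⟩ : WeierstrassCurve ℚ) (ringClassField K ι (9 * p * (ℓ * ℓ'))) γ y))) =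
          φ₀ • geomReduction hΔ ((RatClosure.pointsEquiv (K := K) (⟨0, 0, 1, 0, -1⟩ : WeierstrassCurve ℚ)).symm
            (g • ιe (pointGalHom (⟨0, 0, 1, 0, -1⟩ : WeierstrassCurve ℚ) (ringClassField K ι (9 * p * (ℓ * ℓ'))) γ yℓ'))) := by
    intro φ₀ hφ₀ g γ
    rw [hιe, hιe]
    exact geomReduction_pair_eq_frob_smul hES2 hK hdK ι Dt hp3 hℓ2 hℓ3 hℓ' hℓ'3 hne hℓp hinert
      (m := 9 * p * (ℓ * ℓ')) (by ring) hy hyℓ' (Affine.Point.map (W' := (⟨0, 0, 1, 0, -1⟩ : WeierstrassCurve ℚ)) emb.toRatAlgHom) emb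
      (fun hab ↦ ⟨_, rfl⟩) hΔ hφ₀ g γ
  refine ⟨hA₁, hQN, hP₁, hNvB, fun v hv ↦ ?_⟩
  have hflip := flip_levelPair hω h2 ι Dt hp hp3 hℓ3 hℓ2 hℓp hℓ' hℓ'3 hne hℓ'p hℓA hℓdK hFrobA hΔ κ hκG hκ' hvBc
    hvB hvAc hvA0 hvB3 hvA3 hψB hψA hρ hρρ hlawB hlawA hρcomm emb hemb ιe hιe N hN N₀ hN₀2
    (fun i : ((ringClassField K ι (9 * p) ≃ₐ[K] ringClassField K ι (9 * p)) ⧸ H) × H' ↦ t (i.1, (i.2 : H))) hσ hσ' hy hyℓ'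
    (hdivA := hdivA) (hdivB := hdivB) hA₁ hA₂ hP₁ hP₂ v hv (hPmFrob v hv) (hsel₂ v hv) hES
  rwa [hcls] at hflip

end Summit.BirchSwinnertonDyer.BirchSwinnertonDyer.Theorems.SylvesterTwoCMHalf

end
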